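import Mathlib
import HarnessLib

/-!
# Route `RadicialJung`, crux `CleanModels` (stmt-15917), stub `stub_cleanLU3DefectArcInfinite`: first-order TAYLOR formulas for
# multivariate polynomials — along a one-parameter displacement, along a derivation, and between two points

Line `Sketch` rev 20 of crux stmt-ResolutionOfSingularities-15917; lead `res-B-lead-1` g3.  OURS (generic commutative algebra); nothing
here proves resolution in characteristic `p`.

* `MvPolynomial.exists_eval_add_mul_eq` — `H(P + t θ) = H(P) + t · Σᵢ θᵢ (∂ᵢH)(P) + t² ρ` for some `ρ` (one-parameter Taylor to second
  order, any commutative ring).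
* `MvPolynomial.exists_eval_sub_eval_eq` — `H(P) - H(a) = Σᵢ (Pᵢ - aᵢ) Gᵢ` for some `G`.
* `MvPolynomial.derivation_aeval_eq_sum` — **chain rule**: for a derivation `D` of `K` killing the coefficient ring `T`,
  `D (H(a)) = Σᵢ (∂ᵢH)(a) · D aᵢ`.
Used at a quadratic-transform stage `Rⱼ` with `t = πʲ` (arc coordinates `aᵢ = P̃ᵢ(π) + πʲ θᵢ`) and with the `Q`-constant
coefficients of `…CleanLU3ArcQConst.lean`, which every derivation kills.
-/

noncomputable section

set_option linter.dupNamespace false -- mandated namespace of this single-conjunct summit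

namespace Summit.ResolutionOfSingularities.ResolutionOfSingularities.Theorems.RadicialJung.CleanModels

open MvPolynomial

variable {σ : Type*} [Fintype σ] [DecidableEq σ]

omit [Fintype σ] in
/-- `∂_l (H · Xᵢ)` evaluated under a ring hom `f` at `a`: `(∂_l H)(a) aᵢ + [l = i] H(a)`. [folklore] -/
theorem MvPolynomial.eval₂_pderiv_mul_X {S A : Type*} [CommRing S] [CommRing A] (f : S →+* A) (H : MvPolynomial σ S)
    (a : σ → A) (i l : σ) :
    eval₂ f a (pderiv l (H * X i)) = eval₂ f a (pderiv l H) * a i + (if l = i then eval₂ f a H else 0) := by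
  rw [Derivation.leibniz, pderiv_X, smul_eq_mul, smul_eq_mul, eval₂_add, eval₂_mul, eval₂_mul, eval₂_X]
  by_cases h : l = i
  · subst h
    rw [Pi.single_eq_same, eval₂_one, if_pos rfl]; ring
  · rw [Pi.single_eq_of_ne (Ne.symm h), eval₂_zero, if_neg h]; ring

/-- The first-order coefficient of `H · Xᵢ` along `θ` at `P`: `Σ_l θ_l (∂_l (H Xᵢ))(P) = Pᵢ Σ_l θ_l (∂_l H)(P) + θᵢ H(P)`. [folklore] -/
theorem MvPolynomial.sum_mul_eval₂_pderiv_mul_X {S A : Type*} [CommRing S] [CommRing A] (f : S →+* A) (H : MvPolynomial σ S)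
    (a θ : σ → A) (i : σ) :
    (∑ l, θ l * eval₂ f a (pderiv l (H * X i))) = a i * (∑ l, θ l * eval₂ f a (pderiv l H)) + θ i * eval₂ f a H := by
  simp_rw [MvPolynomial.eval₂_pderiv_mul_X f H a i, mul_add, Finset.sum_add_distrib, mul_ite, mul_zero, Finset.sum_ite_eq',
    Finset.mem_univ, if_true, Finset.mul_sum]
  congr 1
  exact Finset.sum_congr rfl fun l _ => by ring

/-- **One-parameter Taylor expansion to second order**: `H(P + t θ) = H(P) + t Σᵢ θᵢ (∂ᵢH)(P) + t² ρ`. [folklore] -/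
theorem MvPolynomial.exists_eval_add_mul_eq {S : Type*} [CommRing S] (H : MvPolynomial σ S) (P θ : σ → S) (t : S) :
    ∃ ρ : S, eval (fun i => P i + t * θ i) H = eval P H + t * (∑ i, θ i * eval P (pderiv i H)) + t ^ 2 * ρ := by
  induction H using MvPolynomial.induction_on with
  | C a => exact ⟨0, by simp⟩
  | add p q hp hq =>
    obtain ⟨ρ₁, h₁⟩ := hp
    obtain ⟨ρ₂, h₂⟩ := hq
    refine ⟨ρ₁ + ρ₂, ?_⟩
    have e : (∑ i, θ i * eval P (pderiv i (p + q))) =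
        (∑ i, θ i * eval P (pderiv i p)) + ∑ i, θ i * eval P (pderiv i q) := by
      rw [← Finset.sum_add_distrib]
      exact Finset.sum_congr rfl fun i _ => by rw [map_add, map_add, mul_add]
    rw [map_add, map_add, h₁, h₂, e]
    ring
  | mul_X p i hp =>
    obtain ⟨ρ, hρ⟩ := hp
    refine ⟨(∑ l, θ l * eval P (pderiv l p)) * θ i + ρ * (P i + t * θ i), ?_⟩
    have key := MvPolynomial.sum_mul_eval₂_pderiv_mul_X (RingHom.id S) p P θ i
    change (∑ l, θ l * eval P (pderiv l (p * X i))) = P i * (∑ l, θ l * eval P (pderiv l p)) + θ i * eval P p at key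
    rw [key, map_mul, eval_X, hρ, map_mul, eval_X]
    ring

/-- **Difference of values**: `H(P) - H(a) = Σᵢ (Pᵢ - aᵢ) Gᵢ` for suitable `G`. [folklore] -/
theorem MvPolynomial.exists_eval_sub_eval_eq {S : Type*} [CommRing S] (H : MvPolynomial σ S) (P a : σ → S) :
    ∃ G : σ → S, eval P H - eval a H = ∑ i, (P i - a i) * G i := by
  induction H using MvPolynomial.induction_on with
  | C c => exact ⟨0, by simp⟩
  | add p q hp hq =>
    obtain ⟨G₁, h₁⟩ := hp
    obtain ⟨G₂, h₂⟩ := hq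
    refine ⟨G₁ + G₂, ?_⟩
    have e : (∑ i, (P i - a i) * (G₁ + G₂) i) = (∑ i, (P i - a i) * G₁ i) + ∑ i, (P i - a i) * G₂ i := by
      rw [← Finset.sum_add_distrib]
      exact Finset.sum_congr rfl fun i _ => by rw [Pi.add_apply, mul_add]
    rw [map_add, map_add, e, ← h₁, ← h₂]
    ring
  | mul_X p i hp =>
    obtain ⟨G, hG⟩ := hp
    refine ⟨fun l => G l * P i + (if l = i then eval a p else 0), ?_⟩
    have e : (∑ l, (P l - a l) * (G l * P i + if l = i then eval a p else 0)) =
        (∑ l, (P l - a l) * G l) * P i + (P i - a i) * eval a p := by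
      simp_rw [mul_add, Finset.sum_add_distrib, mul_ite, mul_zero, Finset.sum_ite_eq', Finset.mem_univ, if_true,
        Finset.sum_mul]
      congr 1
      exact Finset.sum_congr rfl fun l _ => by ring
    rw [e, ← hG, map_mul, map_mul, eval_X, eval_X]
    ring

/-- **Chain rule along a derivation killing the coefficients**: for a commutative ring `T` mapping to the ring `K`, a derivation `D`
of `K` vanishing on the image of `T`, a polynomial `H` over `T` and a point `a`, `D (H(a)) = Σᵢ (∂ᵢH)(a) · D aᵢ`. [folklore] -/
theorem MvPolynomial.derivation_aeval_eq_sum {T K : Type*} [CommRing T] [CommRing K] [Algebra T K] (D : Derivation ℤ K K)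
    (hT : ∀ t : T, D (algebraMap T K t) = 0) (a : σ → K) (H : MvPolynomial σ T) :
    D (aeval a H) = ∑ i, aeval a (pderiv i H) * D (a i) := by
  induction H using MvPolynomial.induction_on with
  | C t => simp [hT]
  | add p q hp hq =>
    rw [map_add, map_add, hp, hq, ← Finset.sum_add_distrib]
    exact Finset.sum_congr rfl fun i _ => by rw [map_add, map_add, add_mul]
  | mul_X p i hp =>
    have key := MvPolynomial.sum_mul_eval₂_pderiv_mul_X (algebraMap T K) p a (fun l => D (a l)) i
    have e1 : ∀ q : MvPolynomial σ T, aeval a q = eval₂ (algebraMap T K) a q := fun q => rfl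
    simp only [e1] at hp ⊢
    rw [eval₂_mul, eval₂_X, Derivation.leibniz, smul_eq_mul, smul_eq_mul, hp]
    have e2 : (∑ l, eval₂ (algebraMap T K) a (pderiv l (p * X i)) * D (a l)) =
        ∑ l, D (a l) * eval₂ (algebraMap T K) a (pderiv l (p * X i)) := Finset.sum_congr rfl fun l _ => mul_comm _ _
    rw [e2, key]
    have e3 : (∑ l, D (a l) * eval₂ (algebraMap T K) a (pderiv l p)) = ∑ l, eval₂ (algebraMap T K) a (pderiv l p) * D (a l) :=
      Finset.sum_congr rfl fun l _ => mul_comm _ _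
    rw [e3]
    ring

end Summit.ResolutionOfSingularities.ResolutionOfSingularities.Theorems.RadicialJung.CleanModels

end
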